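import Literature.NumberTheory.LFunctions.RodgersTaoEnergy
import Literature.NumberTheory.LFunctions.DobnerLemma4Proofs
import HarnessLib

/-!
# Rodgers–Tao 2020, §3 «Riemann–von Mangoldt type formulae»: Lemma 3.1 (spacing of the classical
# locations), Theorem 3.2 (Riemann–von Mangoldt for `H_t`), Corollary 3.3 (macroscopic structure
# of the zeros), and the displays (37)–(41), (47) — STATEMENTS AS PRINTED

LABEL (C3 / rh-crit-rt, LADDER-RH §1 COLUMN 3 DBN, bears_on N-C/N-P): **RH-FREE LITERATURE
TYPING.** Lemma 3.1 and display (39) are RH-FREE real analysis about `Ψ` and its inverse `ξ`.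
Theorem 3.2, Corollary 3.3 and the `t = 0` displays (37), (40), (41), (47) are printed under the
paper's §1.2 standing hypothesis `Λ < 0` (for times `Λ < t ≤ 0`); they are typed AS PRINTED with
that hypothesis explicit and are therefore **VACUOUS-AS-PRINTED (Λ ≥ 0)**: the tree proves
`Λ ≥ 0` (`Literature.NumberTheory.LFunctions.rodgers_tao_holds`), so each of them holds EX FALSO
(recorded in the last section, tagged EX-FALSO, 0 content). Nothing in this module is worded as, or
is, progress toward RH; formalising §3 fixes notation for §§4–9, it does not move RH. WHAT THIS IS
NOT: an RvM formula for `H_t` at any `t ≥ Λ` (that is Ki–Kim–Lee 2009 Thm 1.4 / Polymath15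
Thm 1.5, not this paper); nothing here bears on the truth of RH.

Source: B. Rodgers, T. Tao, *The de Bruijn–Newman constant is non-negative*, Forum Math. Pi 8
(2020) e6 (bib key `RodgersTaoFMP2020`) = arXiv:1801.05914. VERSIONS/PAGES OPENED (charter §3.2):
arXiv v4 TeX `rh-crit/rt/src/RodgersTao_arXiv1801.05914v4.tex` l.543–704 (the whole of §3) and
the published pages FMP pp.20–23 (`rh-crit/rt/src/RodgersTao2020_FMP8e6_pages/p0020–p0023.txt`);
the held corpus text `paper:arxiv-1801.05914` chunks p0010–p0011 is arXiv **v2**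
(rt/RT-VERSIONS-lit-1.md §5). Numbering: arXiv v2/v4 «Lemma 3.1 / Theorem 3.2 / Corollary 3.3» =
FMP/v5 «Lemma 8 (p.21) / Theorem 9 (p.23) / Corollary 10 (p.23)»; equation numbers (37)–(52) are the
same in every version. The three statements are byte-identical in v2/v4/v5 (lit-1 concordance); the
only v2→v4 change inside §3 is display (39): v2 `Ψ′(T) = log T/(4π)`, «`Ψ` increasing for `T > 1`»
→ v4/FMP `Ψ′(T) = (1/4π) log(T/4π)`, «increasing for `T > 4π`» (the tree's
`hasDerivAt_rodgersTaoPsi` / `strictMonoOn_rodgersTaoPsi` already carry the v4 form). Decl names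
use the arXiv numbering (as the tree's `RodgersTao*.lean` files and the cell DAG do); every cite
tag gives both numbers and the FMP page.

## What the tree already has (CITED, not restated — rt/DICTIONARY.md)

`Ψ` = `rodgersTaoPsi` ((38)), `Ψ′` = `hasDerivAt_rodgersTaoPsi` and `strictMonoOn_rodgersTaoPsi`
((39)), `ξ_y` = `classicalLocation y` (real `y ≥ −1`; (42)) with `rodgersTaoPsi_classicalLocation`,
`four_pi_le_classicalLocation`, `strictMonoOn_classicalLocation`, the window bounds
`self_le_classicalLocation`, `classicalLocation_le_sixteen_pi_mul` and the window form of
Lemma 3.1 (iii) `classicalLocation_gap_window` (RodgersTaoEnergyProofs); `N_t(I)` =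
`deBruijnZeroCount t I` and `x_j(t)` = `deBruijnZero t j` (`j : ℕ`, `x_0 = 0` unused) with the
`t > Λ` API of `RodgersTaoZeroSet.lean`; "`Λ < t`" is rendered `sInf`-free as
`∃ t₁ < t, HasOnlyRealZeros (deBruijnH t₁)` exactly as there; the classical Riemann–von Mangoldt
formula for `ζ` is the tree THEOREM `riemann_von_mangoldt_holds` (ZetaArgVariation.lean).

## Lean rendering of the asymptotic notation (§1.2 of the source, v4 l.210–236)

`log₊ x := log(2 + |x|)` is `RodgersTao2020.logPlus`. "`X = O(Y)`" / "`X ≪ Y`" (absolute constant,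
allowed to depend on the fixed real number `Λ` and, where the source says so, on `C`) is
`∃ A, … |X| ≤ A·Y` with `A` quantified BEFORE everything it must not depend on; "`X ≍ Y`" is
`∃ c C, 0 < c ∧ … c·Y ≤ X ≤ C·Y`; "`o_{T→∞}(Y)`" is `∀ ε > 0, ∃ T₀, ∀ T ≥ T₀, |X| ≤ ε·Y` (and
likewise `o_{j→∞}`), with the threshold quantified before every parameter in which the source's
decay rate is uniform (`t`, `α`, `k`). The index set `ℤ* = ℤ ∖ {0}` with the odd extensions
`ξ_{−j} = −ξ_j`, `x_{−j}(t) = −x_j(t)` is `classicalLocationInt` / `deBruijnZeroInt`; statements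
whose clause for `−j` is literally the clause for `j` under these extensions ((47), (50), (51)) are
typed for `j ≥ 1` only, with a «Divergence» line.

## Fact-vs-theorem boundary of this file

Definitions with bodies: `logPlus`, `classicalLocationInt`, `deBruijnZeroInt` (+ unfolding API,
proved). NAMED FACTS (`def … : Prop`): `lemma31_i`, `lemma31_i_order`, `lemma31_ii`, `lemma31_iii`
(RH-FREE CONTENT — to be discharged in the companion `RodgersTaoRiemannVonMangoldtProofs.lean`;
`lemma31_iii` is typed in CORRECTED form, main term `4π(k−j)/log(ξ_j/4π)`: the as-printed
`…/log ξ_j` is false, see the ERRATUM in its docstring — the only as-printed defect found in §3);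
`eq37`, `eq40`, `eq41`, `eq47`, `eq47_order`, `eq47_gaps`, `thm32_bigO` ((48)), `thm32_littleO`
((49)), `cor33_location` ((50)), `cor33_order` ((51)), `cor33_gaps` ((52)) — VACUOUS-AS-PRINTED,
each discharged EX FALSO in the last section of THIS file from `rodgers_tao_holds` (so that no
prover seat is ever spent on them; these `_holds` carry 0 content and say so). NOT here: the proofs
of Thm 3.2 (argument principle on the contour `Γ_I ∪ Γ_II` + Jensen; limiting-profile argument) —
their RH-FREE content is the reduction «Lemma 2.1 estimates at `t` ∧ `HasOnlyRealZeros (H_t)` ⟹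
(48)/(49) at `t`», which belongs in the Proofs companion as `…_of_…` theorems (no new facts).

## References

* [RodgersTaoFMP2020] B. Rodgers, T. Tao, Forum Math. Pi 8 (2020) e6 = arXiv:1801.05914v4, §3:
  (37)–(41) p.20, (42) + Lemma 8 = Lemma 3.1 ((43)–(45)) p.21, (46)–(47) p.22, Theorem 9 =
  Theorem 3.2 ((48)–(49)) and Corollary 10 = Corollary 3.3 ((50)–(52)) p.23; §1.2 (notation) p.6–7.
* [Titchmarsh1986] E. C. Titchmarsh, *The Theory of the Riemann Zeta-Function*, 2nd ed., Thm. 9.4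
  (Riemann–von Mangoldt), Thm. 13.6 and Thm. 14.13 (Littlewood) — as cited by the source for (37),
  (41).
-/

noncomputable section

open Real Set

namespace Literature.NumberTheory.LFunctions.RodgersTao2020

/-! ## Notation of §1.2: `log₊`, the index set `ℤ*` and the odd extensions of `ξ_j`, `x_j(t)` -/

/-- RH-FREE (notation). The modified logarithm `log₊ x := log(2 + |x|)` of Rodgers–Tao 2020, §1.2
("to avoid the minor issue of the logarithm occasionally being negative"; v4 l.216, FMP p.7).
Always `≥ log 2 > 0`. [cite: RodgersTaoFMP2020, §1.2 p.7] -/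
def logPlus (x : ℝ) : ℝ := Real.log (2 + |x|)

/-- Unfolding lemma for `log₊`. [cite: RodgersTaoFMP2020, §1.2 p.7] -/
theorem logPlus_eq (x : ℝ) : logPlus x = Real.log (2 + |x|) := rfl

/-- `log₊` is even (notation of §1.2). [cite: RodgersTaoFMP2020, §1.2 p.7] -/
@[simp] theorem logPlus_neg (x : ℝ) : logPlus (-x) = logPlus x := by
  simp [logPlus, abs_neg]

/-- `log 2 ≤ log₊ x` (notation of §1.2: `log₊ ≥ log 2`). [cite: RodgersTaoFMP2020, §1.2 p.7] -/
theorem log_two_le_logPlus (x : ℝ) : Real.log 2 ≤ logPlus x :=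
  Real.log_le_log (by norm_num) (by linarith [abs_nonneg x])

/-- `0 < log₊ x` («to avoid the minor issue of the logarithm occasionally being negative», §1.2). [cite: RodgersTaoFMP2020, §1.2 p.7] -/
theorem logPlus_pos (x : ℝ) : 0 < logPlus x :=
  lt_of_lt_of_le (Real.log_pos (by norm_num)) (log_two_le_logPlus x)

/-- `log₊` is monotone in `|x|` (notation of §1.2). [cite: RodgersTaoFMP2020, §1.2 p.7] -/
theorem logPlus_le_logPlus {x y : ℝ} (h : |x| ≤ |y|) : logPlus x ≤ logPlus y :=
  Real.log_le_log (by linarith [abs_nonneg x]) (by linarith)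

/-- For `x ≥ 0`, `log₊ x = log(2 + x)` (notation of §1.2). [cite: RodgersTaoFMP2020, §1.2 p.7] -/
theorem logPlus_of_nonneg {x : ℝ} (hx : 0 ≤ x) : logPlus x = Real.log (2 + x) := by
  rw [logPlus, abs_of_nonneg hx]

/-- `log x ≤ log₊ x` for `x > 0` (notation of §1.2). [cite: RodgersTaoFMP2020, §1.2 p.7] -/
theorem log_le_logPlus {x : ℝ} (hx : 0 < x) : Real.log x ≤ logPlus x := by
  rw [logPlus_of_nonneg hx.le]
  exact Real.log_le_log hx (by linarith)

/-- RH-FREE (notation). The classical locations on `ℤ* = ℤ ∖ {0}`: "extend this to negative `j` by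
setting `ξ_{−j} := −ξ_j`" (§3, v4 l.571, FMP p.21), i.e. `sign(j) · ξ_{|j|}` with the tree's
real-indexed `classicalLocation`. Junk value `0` at the unused index `j = 0`.
[cite: RodgersTaoFMP2020, §3 eq. (42) p.21] -/
def classicalLocationInt (j : ℤ) : ℝ := (Int.sign j : ℝ) * classicalLocation ((j.natAbs : ℕ) : ℝ)

/-- For `n ≥ 1` (`n : ℕ`): `ξ_n^{ℤ} = ξ_n`, i.e. the extension to `ℤ*` restricts to the printed
`ξ_j`, `j ≥ 1`. [cite: RodgersTaoFMP2020, §3 eq. (42) p.21] -/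
theorem classicalLocationInt_natCast {n : ℕ} (hn : 1 ≤ n) :
    classicalLocationInt (n : ℤ) = classicalLocation (n : ℝ) := by
  have h : Int.sign (n : ℤ) = 1 := Int.sign_eq_one_of_pos (by exact_mod_cast hn)
  simp [classicalLocationInt, h]

/-- The extension is odd: `ξ_{−j} = −ξ_j`. [cite: RodgersTaoFMP2020, §3 p.21] -/
@[simp] theorem classicalLocationInt_neg (j : ℤ) :
    classicalLocationInt (-j) = -classicalLocationInt j := by
  simp [classicalLocationInt, Int.sign_neg, Int.natAbs_neg]

/-- RH-FREE (notation). The zeros on `ℤ*`: "`x_{−j}(t) = −x_j(t)` for all `j ≥ 1`" (§1.2, v4 l.222,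
FMP p.7), i.e. `sign(j) · x_{|j|}(t)` with the tree's `deBruijnZero t : ℕ → ℝ`. Junk `0` at `j = 0`
(the tree's `x_0(t) = 0` convention). [cite: RodgersTaoFMP2020, §1.2 p.7] -/
def deBruijnZeroInt (t : ℝ) (j : ℤ) : ℝ := (Int.sign j : ℝ) * deBruijnZero t j.natAbs

/-- For `n : ℕ`, `n ≥ 1`: `x_n^{ℤ}(t) = x_n(t)`, i.e. the extension to `ℤ*` restricts to the
printed `x_j(t)`, `j ≥ 1`. [cite: RodgersTaoFMP2020, §1.2 p.7] -/
theorem deBruijnZeroInt_natCast (t : ℝ) {n : ℕ} (hn : 1 ≤ n) :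
    deBruijnZeroInt t (n : ℤ) = deBruijnZero t n := by
  have h : Int.sign (n : ℤ) = 1 := Int.sign_eq_one_of_pos (by exact_mod_cast hn)
  simp [deBruijnZeroInt, h]

/-- The extension is odd: `x_{−j}(t) = −x_j(t)`. [cite: RodgersTaoFMP2020, §1.2 p.7] -/
@[simp] theorem deBruijnZeroInt_neg (t : ℝ) (j : ℤ) :
    deBruijnZeroInt t (-j) = -deBruijnZeroInt t j := by
  simp [deBruijnZeroInt, Int.sign_neg, Int.natAbs_neg]

/-! ## Display (39) and the definition (42): CITED

(38) `Ψ(T) := (T/4π) log(T/4π) − T/4π` is `rodgersTaoPsi`; (39) `Ψ′(T) = (1/4π) log(T/4π)`,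
"in particular `Ψ` is increasing for `T > 4π`" (v4/FMP p.20; the v2 text has `log T/4π` and
`T > 1`) is `hasDerivAt_rodgersTaoPsi` + `strictMonoOn_rodgersTaoPsi`; (42) `Ψ(ξ_j) = j`, "the
unique quantity in `(1, +∞)`" — in the tree the unique solution in `[4π, ∞)`, which for `j ≥ 1` is
the printed one since `Ψ < 0 < 1 ≤ j` on `(0, 4πe)` — is `rodgersTaoPsi_classicalLocation` /
`classicalLocation_eq`; "Clearly the `ξ_j` are increasing in `j`" is
`strictMonoOn_classicalLocation`. Nothing of this is re-declared here. -/

/-! ## Lemma 3.1 (= FMP Lemma 8, p.21): spacing of the classical locations — RH-FREE named facts -/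

/-- RH-FREE — Rodgers–Tao 2020 **Lemma 3.1 (i)** = FMP Lemma 8 (i), eq. (43) (arXiv:1801.05914v4
l.575–579; FMP p.21): «For any `j ≥ 1`, one has `ξ_j = (1 + o_{|j|→∞}(1)) 4πj/log₊ j`.» Rendered:
for every `ε > 0` there is `j₀` such that `|ξ_j · log₊ j/(4πj) − 1| ≤ ε` for all real `j ≥ j₀`
(with `j ≥ 1`). Typed range: real `j` (printed: integer `j ≥ 1`; RT Remark 2.2 n/a — no `t` here).
Divergence: the index is real (the tree's `classicalLocation` is real-indexed and the printed proof,
v4 l.593–600, never uses integrality); the integer statement is the restriction. CONTENT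
(dischargeable real analysis: inversion of `Ψ`). [cite: RodgersTaoFMP2020, Lemma 3.1 (i) = Lemma 8 (i) eq. (43) p.21] -/
def lemma31_i : Prop :=
  ∀ ε : ℝ, 0 < ε → ∃ j₀ : ℝ, ∀ j : ℝ, 1 ≤ j → j₀ ≤ j →
    |classicalLocation j * logPlus j / (4 * π * j) - 1| ≤ ε

/-- RH-FREE — Rodgers–Tao 2020 **Lemma 3.1 (i), second clause** (v4 l.579; FMP p.21): «In
particular, `ξ_j ≍ j/log₊ j` and `log₊ ξ_j ≍ log₊ j`» (for all `j ≥ 1`, absolute constants).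
Rendered with one pair of constants `0 < c ≤ C` serving both comparisons (equivalent to two pairs).
Typed range / divergence: real `j ≥ 1`, as for `lemma31_i`. CONTENT.
[cite: RodgersTaoFMP2020, Lemma 3.1 (i) = Lemma 8 (i) p.21] -/
def lemma31_i_order : Prop :=
  ∃ c C : ℝ, 0 < c ∧ c ≤ C ∧ ∀ j : ℝ, 1 ≤ j →
    c * (j / logPlus j) ≤ classicalLocation j ∧ classicalLocation j ≤ C * (j / logPlus j) ∧
      c * logPlus j ≤ logPlus (classicalLocation j) ∧ logPlus (classicalLocation j) ≤ C * logPlus j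

/-- RH-FREE — Rodgers–Tao 2020 **Lemma 3.1 (ii)** = FMP Lemma 8 (ii), eq. (44) (v4 l.580–583; FMP
p.21): «For any `j, k ∈ ℤ*`, one has `|ξ_k − ξ_j| ≍ |k − j|/log₊(|ξ_j| + |ξ_k|)`.» Rendered over
`ℤ* = {j : ℤ | j ≠ 0}` with the odd extension `classicalLocationInt` (`ξ_{−j} = −ξ_j`), absolute
constants `0 < c ≤ C` (for `j = k` both sides vanish). Typed range: as printed. Divergence: none.
CONTENT. [cite: RodgersTaoFMP2020, Lemma 3.1 (ii) = Lemma 8 (ii) eq. (44) p.21] -/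
def lemma31_ii : Prop :=
  ∃ c C : ℝ, 0 < c ∧ c ≤ C ∧ ∀ j k : ℤ, j ≠ 0 → k ≠ 0 →
    c * (|(k : ℝ) - j| / logPlus (|classicalLocationInt j| + |classicalLocationInt k|)) ≤
        |classicalLocationInt k - classicalLocationInt j| ∧
      |classicalLocationInt k - classicalLocationInt j| ≤
        C * (|(k : ℝ) - j| / logPlus (|classicalLocationInt j| + |classicalLocationInt k|))

/-- RH-FREE — Rodgers–Tao 2020 **Lemma 3.1 (iii)** = FMP Lemma 8 (iii), eq. (45) (v4 l.584–589;
FMP p.21), CORRECTED FORM: «If `1 ≤ j ≍ k`, then one has the more precise approximation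
`ξ_k − ξ_j = 4π(k − j)/log ξ_j + O(|k − j|²/(j log² ξ_j))`. Of course, the implied constant in the
error term in (45) can depend on the implied constants in the hypothesis `j ≍ k`.» Rendered: for
every comparability constant `K ≥ 1` there is `A` such that for all real `j, k ≥ 1` with `j ≤ K k`
and `k ≤ K j`, `|ξ_k − ξ_j − 4π(k−j)/log(ξ_j/4π)| ≤ A (k−j)²/(j (log ξ_j)²)`.
**ERRATUM (as-printed (45) is false; typed with the main term the printed proof yields).** The
printed main term has `log ξ_j`; the printed proof (v4 l.602–616: «by the mean value theorem and
(39) we have `(1/4π) log(T/4π)(ξ_k − ξ_j) = k − j` for some `T` between `ξ_k` and `ξ_j` … `1/log T =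
1/log ξ_j + O(|k−j|/(j log² ξ_j))`, giving (45)») silently replaces `log(T/4π)` by `log T` in its last
three displays (the paper's footnote to (38): «the factors of `4π` … may be ignored by the reader on
a first reading»; the v2 text even printed (39) as `Ψ′(T) = log T/4π`). With `log ξ_j` the claimed
error is violated already for `k = j + 1`: `ξ_{j+1} − ξ_j = 4π/log(θ/4π)` exactly (`θ ∈ (ξ_j,
ξ_{j+1})`), so `ξ_{j+1} − ξ_j − 4π/log ξ_j = 4π (log 4π − log(θ/ξ_j))/(log(θ/4π) log ξ_j) ≥
2π/log² ξ_j` for large `j`, which is not `O(1/(j log² ξ_j))`. The corrected main term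
`4π(k−j)/log(ξ_j/4π)` is what the mean-value argument gives, and every later use of (45) in the
source ((stat) of §7, v4 l.1163–1167; l.1058–1062; l.1111; l.1202; l.1320; l.1390; l.1417; l.1544)
only uses that the main-term coefficient does not depend on `k` (it cancels in the odd sums) or
absorbs the `O(|k−j|/log² ξ_j)` discrepancy into a displayed larger error, so the correction is
immaterial downstream. The formal refutation of the as-printed form (stated inline there, not as
a named `Prop` here) and the discharge of this corrected form belong to the Proofs companion.
Typed range: real `j, k ≥ 1`. Divergence: (1) main term
`log(ξ_j/4π)` for the printed `log ξ_j` (erratum above); (2) real indices (the proof is the mean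
value theorem for `Ψ`, verbatim for reals; cf. the tree's real-indexed window form
`classicalLocation_gap_window`, whose `|(ξ_{j+1} − ξ_j) log T/(4π) − 1| ≤ log(4π)/(log T − log 4π)`
exhibits the same `log 4π/log T` discrepancy). CONTENT.
[cite: RodgersTaoFMP2020, Lemma 3.1 (iii) = Lemma 8 (iii) eq. (45) p.21] -/
def lemma31_iii : Prop :=
  ∀ K : ℝ, 1 ≤ K → ∃ A : ℝ, ∀ j k : ℝ, 1 ≤ j → 1 ≤ k → j ≤ K * k → k ≤ K * j →
    |classicalLocation k - classicalLocation j -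
        4 * π * (k - j) / Real.log (classicalLocation j / (4 * π))| ≤
      A * ((k - j) ^ 2 / (j * Real.log (classicalLocation j) ^ 2))

/-! ## The `t = 0` displays (37), (40), (41), (47) — printed under the standing hypothesis `Λ < 0`

In §3 the source first records facts about the zeros `x_j(0)` of `H_0(z) = ξ(½ + iz/2)/8`: «The
classical Riemann–von Mangoldt formula (see e.g. [Titchmarsh, Theorem 9.4]), combined with (3),
gives the asymptotic (37) `N_0([0,T]) = Ψ(T) + O(log₊ T)` for all `T ≥ 0`», then (40), and
«Because we are assuming the Riemann hypothesis (and hence the Lindelöf hypothesis), one can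
improve this latter bound to (41) …, a result of Littlewood (see [Titchmarsh, Theorem 13.6])», and
(47). Here `N_0` counts the REAL zeros of `H_0`, i.e. the zeros of `ζ` ON the critical line (each
once); the identification with all zeros counted with multiplicity is the standing hypothesis
`Λ < 0` of §1.2 (⇒ RH and, by Csordas–Smith–Varga, simplicity). The statements are typed with that
hypothesis as antecedent, `(∃ t₀ < 0, HasOnlyRealZeros (deBruijnH t₀)) → …`, exactly as the tree's
`rodgers_tao_zeros_zero`; they are VACUOUS-AS-PRINTED (Λ ≥ 0). Their RH-FREE core — the
Riemann–von Mangoldt formula for `N(T)` — is the tree theorem `riemann_von_mangoldt_holds`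
(note `Ψ(T) = (T′/2π) log(T′/2π) − T′/2π` at `T′ = T/2`, the `z = 2γ` normalisation of (3)). -/

/-- VACUOUS-AS-PRINTED (Λ ≥ 0); EX-FALSO class — Rodgers–Tao 2020, §3 **display (37)** (v4
l.545–548; FMP p.20): under the §1.2 standing hypothesis `Λ < 0`, «`N_0([0,T]) = Ψ(T) + O(log₊ T)`
for all `T ≥ 0`» (classical Riemann–von Mangoldt combined with (3)). Rendered: `(∃ t₀ < 0, H_{t₀}
has only real zeros) → ∃ A, ∀ T ≥ 0, |N_0([0,T]) − Ψ(T)| ≤ A log₊ T` with `N_0 = deBruijnZeroCount 0`.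
Typed range: as printed (standing hypothesis explicit). Divergence: none. RH-FREE core:
`riemann_von_mangoldt_holds`. [cite: RodgersTaoFMP2020, §3 eq. (37) p.20] -/
def eq37 : Prop :=
  (∃ t₀ : ℝ, t₀ < 0 ∧ HasOnlyRealZeros (deBruijnH t₀)) →
    ∃ A : ℝ, ∀ T : ℝ, 0 ≤ T →
      |(deBruijnZeroCount 0 (Icc 0 T) : ℝ) - rodgersTaoPsi T| ≤ A * logPlus T

/-- VACUOUS-AS-PRINTED (Λ ≥ 0); EX-FALSO class — Rodgers–Tao 2020, §3 **display (40)** (v4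
l.558–562; FMP p.20): «`N_0([T, T+α]) = α log₊ T/(4π) + O(log₊ T)` for all `T ≥ 0` and
`0 ≤ α ≤ C` for any fixed `C`, where the implied constants in the asymptotic notation are allowed
to depend on `C`» (from (37) and the mean value theorem). Rendered with `∀ C, ∃ A, ∀ T ≥ 0,
∀ α ∈ [0, C]`. Typed range: as printed, standing hypothesis explicit. Divergence: none.
[cite: RodgersTaoFMP2020, §3 eq. (40) p.20] -/
def eq40 : Prop :=
  (∃ t₀ : ℝ, t₀ < 0 ∧ HasOnlyRealZeros (deBruijnH t₀)) →
    ∀ C : ℝ, 0 < C → ∃ A : ℝ, ∀ T : ℝ, 0 ≤ T → ∀ α : ℝ, 0 ≤ α → α ≤ C →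
      |(deBruijnZeroCount 0 (Icc T (T + α)) : ℝ) - α * logPlus T / (4 * π)| ≤ A * logPlus T

/-- VACUOUS-AS-PRINTED (Λ ≥ 0); EX-FALSO class (printed as a consequence of RH ⊂ standing
hypothesis) — Rodgers–Tao 2020, §3 **display (41)** (v4 l.562–566; FMP p.20): «Because we are
assuming the Riemann hypothesis (and hence the Lindelöf hypothesis), one can improve this latter
bound to `N_0([T, T+α]) = α log₊ T/(4π) + o_{T→∞}(log₊ T)`, a result of Littlewood (see
[Titchmarsh, Theorem 13.6]).» Rendered with the decay rate uniform in `α ∈ [0, C]` (the reading the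
source USES two paragraphs later, applying (41) «with `α` equal to (or slightly less than)
`x_k(0) − x_j(0)`», an `α` that varies with `j`): `∀ C, ∀ ε > 0, ∃ T₀, ∀ T ≥ T₀, ∀ α ∈ [0,C]`.
Typed range: as printed, standing hypothesis explicit. Divergence: the `α`-uniformity is made
explicit (say so). [cite: RodgersTaoFMP2020, §3 eq. (41) p.20] -/
def eq41 : Prop :=
  (∃ t₀ : ℝ, t₀ < 0 ∧ HasOnlyRealZeros (deBruijnH t₀)) →
    ∀ C : ℝ, 0 < C → ∀ ε : ℝ, 0 < ε → ∃ T₀ : ℝ, ∀ T : ℝ, T₀ ≤ T → ∀ α : ℝ, 0 ≤ α → α ≤ C →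
      |(deBruijnZeroCount 0 (Icc T (T + α)) : ℝ) - α * logPlus T / (4 * π)| ≤ ε * logPlus T

/-- VACUOUS-AS-PRINTED (Λ ≥ 0); EX-FALSO class — Rodgers–Tao 2020, §3 **display (47)** (v4
l.617–622; FMP p.22): «`x_j(0) = ξ_j + O(1)` for all `j ≥ 1`, and hence for all `j ∈ ℤ*` by
symmetry» (from (37) at `T = x_j(0)`, (39) and the mean value theorem). Rendered for `j ≥ 1`
(`j : ℕ`): `∃ A, ∀ j ≥ 1, |x_j(0) − ξ_j| ≤ A`. Typed range: as printed, standing hypothesis explicit.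
Divergence: `j ∈ ℤ*` reduced to `j ≥ 1` — the clause for `−j` IS the clause for `j` under the odd
extensions `deBruijnZeroInt` / `classicalLocationInt` («by symmetry», as printed).
[cite: RodgersTaoFMP2020, §3 eq. (47) p.22] -/
def eq47 : Prop :=
  (∃ t₀ : ℝ, t₀ < 0 ∧ HasOnlyRealZeros (deBruijnH t₀)) →
    ∃ A : ℝ, ∀ j : ℕ, 1 ≤ j → |deBruijnZero 0 j - classicalLocation (j : ℝ)| ≤ A

/-- VACUOUS-AS-PRINTED (Λ ≥ 0); EX-FALSO class — Rodgers–Tao 2020, §3, the display after (47) (v4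
l.622–625; FMP p.22): «In particular, from (43) and the fact that `x_1(0) > 0` we conclude that
`x_j(0) ≍ j/log₊ ξ_j ≍ j/log₊ j` for all `j ≥ 1`.» Rendered: absolute `0 < c ≤ C` with
`c·j/log₊ ξ_j ≤ x_j(0) ≤ C·j/log₊ ξ_j` for `j ≥ 1`; the second `≍` (`j/log₊ ξ_j ≍ j/log₊ j`) is
`t`-free and is the content of `lemma31_i_order`, not repeated. Typed range: as printed.
Divergence: none. [cite: RodgersTaoFMP2020, §3 p.22 (display after (47))] -/
def eq47_order : Prop :=
  (∃ t₀ : ℝ, t₀ < 0 ∧ HasOnlyRealZeros (deBruijnH t₀)) →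
    ∃ c C : ℝ, 0 < c ∧ c ≤ C ∧ ∀ j : ℕ, 1 ≤ j →
      c * ((j : ℝ) / logPlus (classicalLocation (j : ℝ))) ≤ deBruijnZero 0 j ∧
        deBruijnZero 0 j ≤ C * ((j : ℝ) / logPlus (classicalLocation (j : ℝ)))

/-- VACUOUS-AS-PRINTED (Λ ≥ 0); EX-FALSO class — Rodgers–Tao 2020, §3, last display before
Theorem 3.2 (v4 l.628–632; FMP p.23): «if `1 ≤ j < k ≤ j + log₊ j`, then …
`x_k(0) − x_j(0) = 4π(k − j)/log₊ ξ_j + o_{j→∞}(1)`» (from (41) at `T = x_j(0)`). Rendered: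
`∀ ε > 0, ∃ j₀, ∀ j k : ℕ, j₀ ≤ j → j < k → k ≤ j + log₊ j → |x_k(0) − x_j(0) − 4π(k−j)/log₊ ξ_j| ≤ ε`
(decay uniform in `k`, as the unsubscripted `o_{j→∞}` reads). Typed range: as printed, standing
hypothesis explicit. Divergence: none. [cite: RodgersTaoFMP2020, §3 p.23 (display before Theorem 9)] -/
def eq47_gaps : Prop :=
  (∃ t₀ : ℝ, t₀ < 0 ∧ HasOnlyRealZeros (deBruijnH t₀)) →
    ∀ ε : ℝ, 0 < ε → ∃ j₀ : ℕ, ∀ j k : ℕ, j₀ ≤ j → j < k → (k : ℝ) ≤ j + logPlus j →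
      |deBruijnZero 0 k - deBruijnZero 0 j -
          4 * π * ((k : ℝ) - j) / logPlus (classicalLocation (j : ℝ))| ≤ ε

/-! ## Theorem 3.2 (= FMP Theorem 9, p.23): Riemann–von Mangoldt type formulae for `H_t`

Printed range «`Λ < t ≤ 0`». README §0.4 / rt-ref F1b: typed AS PRINTED (option (a)), the
range rendered `sInf`-free as `(∃ t₁ < t, HasOnlyRealZeros (deBruijnH t₁)) ∧ t ≤ 0`, hence
VACUOUS-AS-PRINTED (Λ ≥ 0). NOT re-typed «`Λ < t ≤ C`»: the printed proof (v4 l.668–704) runs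
through Lemma 2.1, whose proof uses `t ≤ 0` (heat-kernel representation (htz) with `|t|`, v4
l.301–306) and `Λ ≤ t` (real zeros: `N_t` = contour count; zero-free lower half-plane for the
branch of `log H_t` in the proof of (49)); Remark 2.2 (v4 l.260) offers the extension `−C < t` for
Lemma 2.1 only and states that «the remaining arguments in this paper» are vacuous when `Λ ≥ 0`.
The implied constants are absolute (§1.2: they may depend on the fixed number `Λ`), i.e. uniform in
`t`; the decay rate in (49) «is permitted to depend on `C` but is otherwise uniform in `α`», and is
uniform in `t` (the printed proof extracts a contradiction from sequences `t_n`, `α_n`, `T_n`). -/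

/-- VACUOUS-AS-PRINTED (Λ ≥ 0); EX-FALSO class — Rodgers–Tao 2020 **Theorem 3.2, eq. (48)** = FMP
Theorem 9 (48) (arXiv:1801.05914v4 l.636–641; FMP p.23): «Let `Λ < t ≤ 0`, `T > 0`, and let
`0 ≤ α ≤ C` for some `C > 0`. Then one has `N_t([0,T]) = Ψ(T) + O(log²₊ T)`.» Rendered: one
absolute `A` with `|N_t([0,T]) − Ψ(T)| ≤ A (log₊ T)²` for all `t` with `Λ < t ≤ 0` and all `T > 0`.
Typed range: as printed («`Λ < t ≤ 0`», `sInf`-free; EMPTY in the tree by `rodgers_tao_holds`).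
Divergence: none. [cite: RodgersTaoFMP2020, Theorem 3.2 (48) = Theorem 9 (48) p.23] -/
def thm32_bigO : Prop :=
  ∃ A : ℝ, ∀ t : ℝ, (∃ t₁ : ℝ, t₁ < t ∧ HasOnlyRealZeros (deBruijnH t₁)) → t ≤ 0 →
    ∀ T : ℝ, 0 < T →
      |(deBruijnZeroCount t (Icc 0 T) : ℝ) - rodgersTaoPsi T| ≤ A * logPlus T ^ 2

/-- VACUOUS-AS-PRINTED (Λ ≥ 0); EX-FALSO class — Rodgers–Tao 2020 **Theorem 3.2, eq. (49)** = FMP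
Theorem 9 (49) (v4 l.642–646; FMP p.23): «… and `N_t([T, T + α log₊ T]) = α log²₊ T/(4π) +
o_{T→∞}(log²₊ T)`. The decay rate in the `o_{T→∞}()` error term is permitted to depend on `C` but
is otherwise uniform in `α`.» Rendered: `∀ C > 0, ∀ ε > 0, ∃ T₀, ∀ t (Λ < t ≤ 0), ∀ α ∈ [0, C],
∀ T ≥ T₀, |N_t([T, T + α log₊ T]) − α (log₊ T)²/(4π)| ≤ ε (log₊ T)²` (threshold before `t` and
`α`: uniform in both, as printed/proved). Typed range: as printed (EMPTY in the tree).
Divergence: none. [cite: RodgersTaoFMP2020, Theorem 3.2 (49) = Theorem 9 (49) p.23] -/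
def thm32_littleO : Prop :=
  ∀ C : ℝ, 0 < C → ∀ ε : ℝ, 0 < ε → ∃ T₀ : ℝ,
    ∀ t : ℝ, (∃ t₁ : ℝ, t₁ < t ∧ HasOnlyRealZeros (deBruijnH t₁)) → t ≤ 0 →
      ∀ α : ℝ, 0 ≤ α → α ≤ C → ∀ T : ℝ, T₀ ≤ T →
        |(deBruijnZeroCount t (Icc T (T + α * logPlus T)) : ℝ) - α * logPlus T ^ 2 / (4 * π)| ≤
          ε * logPlus T ^ 2

/-! ## Corollary 3.3 (= FMP Corollary 10, p.23): macroscopic structure of the zeros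

«Repeating the previous analysis, we conclude …» — printed for `Λ < t ≤ 0`, typed as printed
(VACUOUS-AS-PRINTED (Λ ≥ 0)), constants absolute (uniform in `t`). -/

/-- VACUOUS-AS-PRINTED (Λ ≥ 0); EX-FALSO class — Rodgers–Tao 2020 **Corollary 3.3, eq. (50)** =
FMP Corollary 10 (50) (v4 l.649–653; FMP p.23): «Let `Λ < t ≤ 0`. Then one has
`x_j(t) = ξ_j + O(log₊ ξ_j)` for all `j ∈ ℤ*`.» Rendered for `j ≥ 1` (`j : ℕ`) with one absolute
`A`, uniform in `t`: `|x_j(t) − ξ_j| ≤ A log₊ ξ_j`. Typed range: as printed («`Λ < t ≤ 0`»,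
`sInf`-free). Divergence: `j ∈ ℤ*` reduced to `j ≥ 1` (the clause for `−j` is the clause for `j`
under the odd extensions, `log₊` being even). [cite: RodgersTaoFMP2020, Corollary 3.3 (50) = Corollary 10 (50) p.23] -/
def cor33_location : Prop :=
  ∃ A : ℝ, ∀ t : ℝ, (∃ t₁ : ℝ, t₁ < t ∧ HasOnlyRealZeros (deBruijnH t₁)) → t ≤ 0 →
    ∀ j : ℕ, 1 ≤ j →
      |deBruijnZero t j - classicalLocation (j : ℝ)| ≤ A * logPlus (classicalLocation (j : ℝ))

/-- VACUOUS-AS-PRINTED (Λ ≥ 0); EX-FALSO class — Rodgers–Tao 2020 **Corollary 3.3, eq. (51)** =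
FMP Corollary 10 (51) (v4 l.653–657; FMP p.23): «in particular `x_j(t) ≍ j/log₊ ξ_j ≍ j/log₊ j`
for all `j ≥ 1`.» Rendered: absolute `0 < c ≤ C`, uniform in `t`, with
`c·j/log₊ ξ_j ≤ x_j(t) ≤ C·j/log₊ ξ_j`; the `t`-free second `≍` is `lemma31_i_order`. Typed range:
as printed. Divergence: none. [cite: RodgersTaoFMP2020, Corollary 3.3 (51) = Corollary 10 (51) p.23] -/
def cor33_order : Prop :=
  ∃ c C : ℝ, 0 < c ∧ c ≤ C ∧
    ∀ t : ℝ, (∃ t₁ : ℝ, t₁ < t ∧ HasOnlyRealZeros (deBruijnH t₁)) → t ≤ 0 →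
      ∀ j : ℕ, 1 ≤ j →
        c * ((j : ℝ) / logPlus (classicalLocation (j : ℝ))) ≤ deBruijnZero t j ∧
          deBruijnZero t j ≤ C * ((j : ℝ) / logPlus (classicalLocation (j : ℝ)))

/-- VACUOUS-AS-PRINTED (Λ ≥ 0); EX-FALSO class — Rodgers–Tao 2020 **Corollary 3.3, eq. (52)** =
FMP Corollary 10 (52) (v4 l.657–661; FMP p.23): «We also have
`x_k(t) − x_j(t) = 4π(k − j)/log₊ ξ_j + o_{j→∞}(log₊ ξ_j)` whenever `1 ≤ j < k ≤ j + log²₊ ξ_j`.»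
Rendered: `∀ ε > 0, ∃ j₀, ∀ t (Λ < t ≤ 0), ∀ j k : ℕ, j₀ ≤ j → j < k → k ≤ j + (log₊ ξ_j)² →
|x_k(t) − x_j(t) − 4π(k−j)/log₊ ξ_j| ≤ ε log₊ ξ_j` (threshold before `t` and `k`: the
unsubscripted `o_{j→∞}` is uniform in them, and the proof via Theorem 3.2 gives that). Typed
range: as printed. Divergence: none. [cite: RodgersTaoFMP2020, Corollary 3.3 (52) = Corollary 10 (52) p.23] -/
def cor33_gaps : Prop :=
  ∀ ε : ℝ, 0 < ε → ∃ j₀ : ℕ,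
    ∀ t : ℝ, (∃ t₁ : ℝ, t₁ < t ∧ HasOnlyRealZeros (deBruijnH t₁)) → t ≤ 0 →
      ∀ j k : ℕ, j₀ ≤ j → j < k → (k : ℝ) ≤ j + logPlus (classicalLocation (j : ℝ)) ^ 2 →
        |deBruijnZero t k - deBruijnZero t j -
            4 * π * ((k : ℝ) - j) / logPlus (classicalLocation (j : ℝ))| ≤
          ε * logPlus (classicalLocation (j : ℝ))

/-! ## Vacuity record: EX-FALSO discharges (0 content) of the `Λ < 0`-conditioned facts

The tree proves `Λ ≥ 0` in the `sInf`-free form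
`rodgers_tao_holds : ∀ t < 0, ¬ HasOnlyRealZeros (deBruijnH t)` (Dobner's route,
`DobnerLemma4Proofs.lean`). Hence the standing hypothesis `∃ t₀ < 0, HasOnlyRealZeros (H_{t₀})` is
false and the range «`Λ < t ≤ 0`» is empty; every fact of the two preceding sections holds EX FALSO.
These theorems are recorded so that the facts never enter the literature-debt queue; they carry
NO mathematical content of §3 (rt-ref F1/F1b: grade X) and must never be cited as «Theorem 3.2
formalised». -/

/-- The standing hypothesis of §1.2 is refuted in the tree: no `t₀ < 0` has `H_{t₀}` real-rooted
(`rodgers_tao_holds`, i.e. `Λ ≥ 0`). [cite: RodgersTaoFMP2020, Theorem 1.1] -/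
theorem not_standingHypothesis : ¬ ∃ t₀ : ℝ, t₀ < 0 ∧ HasOnlyRealZeros (deBruijnH t₀) :=
  fun ⟨t₀, ht₀, h⟩ ↦ rodgers_tao_holds t₀ ht₀ h

/-- The printed range «`Λ < t ≤ 0`» is empty in the tree: `Λ < t` (`sInf`-free) and `t ≤ 0` cannot
both hold. [cite: RodgersTaoFMP2020, Theorem 1.1] -/
theorem range_empty {t : ℝ} (hΛ : ∃ t₁ : ℝ, t₁ < t ∧ HasOnlyRealZeros (deBruijnH t₁))
    (ht : t ≤ 0) : False := by
  obtain ⟨t₁, ht₁, h⟩ := hΛ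
  exact rodgers_tao_holds t₁ (by linarith) h

/-- EX-FALSO (vacuous: standing hypothesis refuted by `rodgers_tao_holds`); 0 content.
[cite: RodgersTaoFMP2020, §3 eq. (37) p.20] -/
theorem eq37_holds : eq37 := fun h ↦ (not_standingHypothesis h).elim

/-- EX-FALSO (vacuous: standing hypothesis refuted by `rodgers_tao_holds`); 0 content.
[cite: RodgersTaoFMP2020, §3 eq. (40) p.20] -/
theorem eq40_holds : eq40 := fun h ↦ (not_standingHypothesis h).elim

/-- EX-FALSO (vacuous: standing hypothesis refuted by `rodgers_tao_holds`); 0 content.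
[cite: RodgersTaoFMP2020, §3 eq. (41) p.20] -/
theorem eq41_holds : eq41 := fun h ↦ (not_standingHypothesis h).elim

/-- EX-FALSO (vacuous: standing hypothesis refuted by `rodgers_tao_holds`); 0 content.
[cite: RodgersTaoFMP2020, §3 eq. (47) p.22] -/
theorem eq47_holds : eq47 := fun h ↦ (not_standingHypothesis h).elim

/-- EX-FALSO (vacuous: standing hypothesis refuted by `rodgers_tao_holds`); 0 content.
[cite: RodgersTaoFMP2020, §3 p.22 (display after (47))] -/
theorem eq47_order_holds : eq47_order := fun h ↦ (not_standingHypothesis h).elim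

/-- EX-FALSO (vacuous: standing hypothesis refuted by `rodgers_tao_holds`); 0 content.
[cite: RodgersTaoFMP2020, §3 p.23 (display before Theorem 9)] -/
theorem eq47_gaps_holds : eq47_gaps := fun h ↦ (not_standingHypothesis h).elim

/-- EX-FALSO (vacuous range «`Λ < t ≤ 0`», empty by `rodgers_tao_holds`); 0 content.
[cite: RodgersTaoFMP2020, Theorem 3.2 (48) = Theorem 9 (48) p.23] -/
theorem thm32_bigO_holds : thm32_bigO :=
  ⟨0, fun _ hΛ ht ↦ (range_empty hΛ ht).elim⟩

/-- EX-FALSO (vacuous range «`Λ < t ≤ 0`», empty by `rodgers_tao_holds`); 0 content.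
[cite: RodgersTaoFMP2020, Theorem 3.2 (49) = Theorem 9 (49) p.23] -/
theorem thm32_littleO_holds : thm32_littleO :=
  fun _ _ _ _ ↦ ⟨0, fun _ hΛ ht ↦ (range_empty hΛ ht).elim⟩

/-- EX-FALSO (vacuous range «`Λ < t ≤ 0`», empty by `rodgers_tao_holds`); 0 content.
[cite: RodgersTaoFMP2020, Corollary 3.3 (50) = Corollary 10 (50) p.23] -/
theorem cor33_location_holds : cor33_location :=
  ⟨0, fun _ hΛ ht ↦ (range_empty hΛ ht).elim⟩

/-- EX-FALSO (vacuous range «`Λ < t ≤ 0`», empty by `rodgers_tao_holds`); 0 content.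
[cite: RodgersTaoFMP2020, Corollary 3.3 (51) = Corollary 10 (51) p.23] -/
theorem cor33_order_holds : cor33_order :=
  ⟨1, 1, one_pos, le_rfl, fun _ hΛ ht ↦ (range_empty hΛ ht).elim⟩

/-- EX-FALSO (vacuous range «`Λ < t ≤ 0`», empty by `rodgers_tao_holds`); 0 content.
[cite: RodgersTaoFMP2020, Corollary 3.3 (52) = Corollary 10 (52) p.23] -/
theorem cor33_gaps_holds : cor33_gaps :=
  fun _ _ ↦ ⟨0, fun _ hΛ ht ↦ (range_empty hΛ ht).elim⟩

end Literature.NumberTheory.LFunctions.RodgersTao2020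

end
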